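import Mathlib.Algebra.Field.ZMod
import Mathlib.Algebra.GroupWithZero.Units.Equiv
import Mathlib.Data.ZMod.Basic
import Mathlib.LinearAlgebra.Dimension.Finite
import Mathlib.LinearAlgebra.LinearIndependent.Lemmas
import HarnessLib

/-!
# Rank one without Mordell–Weil: rational multiples, and the norm identity in `ℤ[C_p × C_p]`

Two pieces of elementary algebra used to pass from the "minimal non-trivial subfields" of the
proof of Theorem 2 of T. Dokchitser–V. Dokchitser, *A note on the Mordell–Weil rank modulo `n`*,
J. Number Theory 131 (2011) (arXiv:0910.4588) — "2-descent shows that `rk E/F₃ = rk E/F₅ = 1`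
[…] (e.g. using Magma, over all minimal non-trivial subfields of `F_n`)" — to the fields
`F₃`, `F₅` themselves (Galois over `ℚ` with group `C_p × C_p`, `p = 3, 5`), WITHOUT the
Mordell–Weil theorem (which Lean does not have):

* **Rank one by saturation** (`IsRatMultiple`, `finrank_eq_one_of_forall_isRatMultiple`): if
  `x ∈ M` is non-torsion and every `m ∈ M` satisfies `n • m = a • x` for some `n ≠ 0`, then
  `finrank ℤ M = 1` (`Module.finrank` over `ℤ` is the maximal size of a linearly independent
  family; no finite generation is needed). Images of rank-one groups through which `x` factors
  consist of rational multiples of `x` (`IsRatMultiple.of_finrank_eq_one`).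
* **The norm identity** (`normSum`, `sum_normSum_add_normSum`): for commuting `σ, τ` in a group
  acting on an abelian group `M`, `τ` of exponent `p` (prime), and `N_g m = Σ_{i mod p} g^i m`,
  `Σ_{j mod p} N_{στ^j} m + N_τ m = p • m + N_σ (N_τ m)` — each `σ^a τ^b` with `a ≢ 0` occurs
  exactly once on the left, the identity `p` times. Hence `p • m` is a signed sum of elements
  fixed by `τ` or by some `στ^j` (`nsmul_eq_sum_normSum`, `apply_normSum_self`): the integral
  form of the decomposition of a `ℚ[C_p × C_p]`-module into the invariants of its `p + 1`
  subgroups of order `p`.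

Pure algebra over Mathlib; no number theory is imported here.

## References

* T. Dokchitser, V. Dokchitser, *A note on the Mordell–Weil rank modulo `n`*, J. Number Theory
  131 (2011) 1833–1839, arXiv:0910.4588: proof of Thm. 2. [DokchitserDokchitser2011RankModN]
-/

namespace Literature.Barriers.BirchSwinnertonDyer

/-! ### Rank one: rational multiples of a non-torsion element -/

section RankOne

variable {M : Type} [AddCommGroup M]

/-- `m` is a rational multiple of `x` in the abelian group `M`: `n • m = a • x` for some
integers `n ≠ 0` and `a` (i.e. `m ⊗ 1 ∈ ℚ · (x ⊗ 1)` in `M ⊗ ℚ`). [folklore] -/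
def IsRatMultiple (x m : M) : Prop :=
  ∃ n : ℤ, n ≠ 0 ∧ ∃ a : ℤ, n • m = a • x

/-- `0` is a rational multiple of anything. [folklore] -/
theorem IsRatMultiple.zero (x : M) : IsRatMultiple x 0 :=
  ⟨1, one_ne_zero, 0, by simp⟩

/-- Rational multiples of `x` are closed under addition. [folklore] -/
theorem IsRatMultiple.add {x m m' : M} (h : IsRatMultiple x m) (h' : IsRatMultiple x m') :
    IsRatMultiple x (m + m') := by
  obtain ⟨n, hn, a, ha⟩ := h
  obtain ⟨n', hn', a', ha'⟩ := h'
  refine ⟨n * n', mul_ne_zero hn hn', n' * a + n * a', ?_⟩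
  have e1 : (n * n') • m = (n' * a) • x := by rw [mul_comm, mul_smul, ha, smul_smul]
  have e2 : (n * n') • m' = (n * a') • x := by rw [mul_smul, ha', smul_smul]
  rw [smul_add, e1, e2, ← add_smul]

/-- Rational multiples of `x` are closed under negation. [folklore] -/
theorem IsRatMultiple.neg {x m : M} (h : IsRatMultiple x m) : IsRatMultiple x (-m) := by
  obtain ⟨n, hn, a, ha⟩ := h
  exact ⟨n, hn, -a, by rw [smul_neg, ha, neg_smul]⟩

/-- Rational multiples of `x` are closed under subtraction. [folklore] -/
theorem IsRatMultiple.sub {x m m' : M} (h : IsRatMultiple x m) (h' : IsRatMultiple x m') :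
    IsRatMultiple x (m - m') := by
  rw [sub_eq_add_neg]
  exact h.add h'.neg

/-- Rational multiples of `x` are closed under finite sums. [folklore] -/
theorem IsRatMultiple.sum {x : M} {ι : Type*} (s : Finset ι) (f : ι → M)
    (h : ∀ i ∈ s, IsRatMultiple x (f i)) : IsRatMultiple x (∑ i ∈ s, f i) :=
  Finset.sum_induction f (IsRatMultiple x) (fun _ _ => IsRatMultiple.add) (IsRatMultiple.zero x) h

/-- Saturation: if `p • m` (`p ≠ 0`) is a rational multiple of `x`, so is `m`. [folklore] -/
theorem IsRatMultiple.of_nsmul {x m : M} {p : ℕ} (hp : p ≠ 0) (h : IsRatMultiple x (p • m)) :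
    IsRatMultiple x m := by
  obtain ⟨n, hn, a, ha⟩ := h
  refine ⟨n * p, mul_ne_zero hn (Int.natCast_ne_zero.mpr hp), a, ?_⟩
  rw [mul_smul, natCast_zsmul, ha]

/-- **Images of rank-one groups.** If `N` has `finrank ℤ N = 1`, `φ : N → M` is additive and
`φ x' = x` with `x` non-torsion in `M`, then every `φ u` is a rational multiple of `x`: `x', u`
are `ℤ`-linearly dependent in `N` (a linearly independent pair would give `rank ≥ 2`), and the
coefficient of `u` cannot vanish. [folklore] -/
theorem IsRatMultiple.of_finrank_eq_one {N : Type} [AddCommGroup N] (hN : Module.finrank ℤ N = 1)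
    {x : M} (hx : ∀ n : ℤ, n • x = 0 → n = 0) (φ : N →+ M) (x' : N) (hx' : φ x' = x) (u : N) :
    IsRatMultiple x (φ u) := by
  have hrank : Module.rank ℤ N = 1 := by
    have h := hN
    rw [Module.finrank] at h
    exact Cardinal.toNat_eq_one.mp h
  by_cases hdep : ∃ a b : ℤ, (a ≠ 0 ∨ b ≠ 0) ∧ a • x' + b • u = 0
  · obtain ⟨a, b, hab, h0⟩ := hdep
    have h1 : a • x + b • φ u = 0 := by
      rw [← hx', ← map_zsmul, ← map_zsmul, ← map_add, h0, map_zero]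
    by_cases hb : b = 0
    · subst hb
      rw [zero_smul, add_zero] at h1
      simp only [ne_eq, not_true_eq_false, or_false] at hab
      exact absurd (hx a h1) hab
    · exact ⟨b, hb, -a, by rw [neg_smul]; exact eq_neg_of_add_eq_zero_right h1⟩
  · have hli : LinearIndependent ℤ ![x', u] := LinearIndependent.pair_iff.mpr fun s t hst => by
      by_contra hne
      exact hdep ⟨s, t, not_and_or.mp hne, hst⟩
    have h2 := hli.cardinal_le_rank
    rw [hrank, Cardinal.mk_fin] at h2
    norm_num at h2

/-- **Rank one by saturation.** If `x ∈ M` is non-torsion and every element of `M` is a rational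
multiple of `x`, then `finrank ℤ M = 1`: any two elements are `ℤ`-linearly dependent (so every
linearly independent finite set has at most one element, `rank ≤ 1`), and `{x}` is linearly
independent (`rank ≥ 1`). No finite generation of `M` is assumed. [folklore] -/
theorem finrank_eq_one_of_forall_isRatMultiple {x : M} (hx : ∀ n : ℤ, n • x = 0 → n = 0)
    (h : ∀ m, IsRatMultiple x m) : Module.finrank ℤ M = 1 := by
  apply Module.finrank_eq_of_rank_eq
  apply le_antisymm
  · apply _root_.rank_le
    intro s hs
    by_contra hcard
    rw [not_le] at hcard
    obtain ⟨u, hu, v, hv, huv⟩ := Finset.one_lt_card.mp hcard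
    obtain ⟨n, hn, a, ha⟩ := h u
    obtain ⟨n', hn', a', ha'⟩ := h v
    have hli : LinearIndependent ℤ ![u, v] := by
      have hinj : Function.Injective (![⟨u, hu⟩, ⟨v, hv⟩] : Fin 2 → s) := by
        intro i j hij
        fin_cases i <;> fin_cases j
        · rfl
        · exact absurd (congrArg Subtype.val hij) huv
        · exact absurd (congrArg Subtype.val hij).symm huv
        · rfl
      have := hs.comp _ hinj
      convert this using 1
      ext i
      fin_cases i <;> rfl
    rw [LinearIndependent.pair_iff] at hli
    have h1 := hli (a' * n) (-(a * n'))
      (by rw [mul_smul, ha, neg_smul, mul_smul, ha', smul_smul, smul_smul, mul_comm a' a,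
        add_neg_cancel])
    have ha0 : a = 0 := by
      have := h1.2
      rw [neg_eq_zero, mul_eq_zero] at this
      exact this.resolve_right hn'
    rw [ha0, zero_smul] at ha
    exact hn (hli n 0 (by rw [ha, zero_smul, add_zero])).1
  · have hli : LinearIndependent ℤ (fun _ : Fin 1 => x) := by
      rw [Fintype.linearIndependent_iff]
      intro g hg i
      rw [Fin.sum_univ_one] at hg
      rw [Subsingleton.elim i 0]
      exact hx (g 0) hg
    simpa using hli.cardinal_le_rank

end RankOne

/-! ### The norm identity `Σ_j N_{στ^j} + N_τ = p + N_σ N_τ` -/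

section Norms

variable {G M : Type*} [Group G] [AddCommGroup M] (ρ : G →* AddMonoid.End M) (p : ℕ)
  [hp : Fact p.Prime]

/-- **Norm element.** `N_g m = Σ_{i mod p} g^i • m` for `g` acting on `M` through
`ρ : G →* End M` (meant for `g` of exponent `p`; the sum is over `i : ZMod p` with exponent
`i.val ∈ {0, …, p-1}`). [folklore] -/
def normSum (g : G) (m : M) : M :=
  ∑ i : ZMod p, ρ (g ^ i.val) m

variable {p}

omit hp in
/-- `g ^ (n % p) = g ^ n` when `g ^ p = 1`. [folklore] -/
theorem pow_mod_eq_pow_of_pow_eq_one {g : G} (hg : g ^ p = 1) (n : ℕ) : g ^ (n % p) = g ^ n := by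
  conv_rhs => rw [← Nat.mod_add_div n p]
  rw [pow_add, pow_mul, hg, one_pow, mul_one]

/-- `N_g m` is fixed by `g` when `g ^ p = 1` (reindex `i ↦ i + 1` modulo `p`). [folklore] -/
theorem apply_normSum_self {g : G} (hg : g ^ p = 1) (m : M) :
    ρ g (normSum ρ p g m) = normSum ρ p g m := by
  unfold normSum
  rw [map_sum]
  have key : ∀ i : ZMod p, ρ g (ρ (g ^ i.val) m) = ρ (g ^ (i + 1).val) m := by
    intro i
    have h1 : i + 1 = ((i.val + 1 : ℕ) : ZMod p) := by
      push_cast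
      rw [ZMod.natCast_zmod_val]
    rw [h1, ZMod.val_natCast, pow_mod_eq_pow_of_pow_eq_one hg, pow_succ', map_mul]
    rfl
  simp_rw [key]
  exact Equiv.sum_comp (Equiv.addRight (1 : ZMod p)) (fun i : ZMod p => ρ (g ^ i.val) m)

/-- `N_g` commutes with the action of any `h` commuting with `g`. [folklore] -/
theorem apply_normSum_comm {g h : G} (hc : Commute g h) (m : M) :
    ρ h (normSum ρ p g m) = normSum ρ p g (ρ h m) := by
  unfold normSum
  rw [map_sum]
  refine Finset.sum_congr rfl fun i _ => ?_
  change (ρ h * ρ (g ^ i.val)) m = (ρ (g ^ i.val) * ρ h) m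
  rw [← map_mul, ← map_mul, (hc.pow_left i.val).eq]

/-- **The norm identity in `ℤ[C_p × C_p]`.** For commuting `σ, τ` with `τ ^ p = 1` (`p` prime):
`Σ_{j mod p} N_{στ^j} m + N_τ m = p • m + N_σ (N_τ m)`. Writing `f(a, b) = σ^a τ^b m`
(`a, b mod p`): `N_{στ^j} m = Σ_i f(i, ji)`; for `i ≢ 0` the map `j ↦ ji` is a bijection of
`ℤ/p`, so `Σ_j Σ_i f(i, ji) = p • m + Σ_{i ≢ 0} Σ_b f(i, b)`, while `N_τ m = Σ_b f(0, b)` and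
`N_σ (N_τ m) = Σ_a Σ_b f(a, b)`. [folklore] -/
theorem sum_normSum_add_normSum {σ τ : G} (hστ : Commute σ τ) (hτ : τ ^ p = 1) (m : M) :
    (∑ j : ZMod p, normSum ρ p (σ * τ ^ j.val) m) + normSum ρ p τ m =
      p • m + normSum ρ p σ (normSum ρ p τ m) := by
  have h1 : ∀ j : ZMod p, normSum ρ p (σ * τ ^ j.val) m =
      ∑ i : ZMod p, ρ (σ ^ i.val * τ ^ (j * i).val) m := by
    intro j
    unfold normSum
    refine Finset.sum_congr rfl fun i _ => ?_
    rw [(hστ.pow_right j.val).mul_pow, ← pow_mul, ZMod.val_mul, pow_mod_eq_pow_of_pow_eq_one hτ]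
  have h2 : normSum ρ p τ m = ∑ b : ZMod p, ρ (σ ^ (0 : ZMod p).val * τ ^ b.val) m := by
    unfold normSum
    simp only [ZMod.val_zero, pow_zero, one_mul]
  have h3 : normSum ρ p σ (normSum ρ p τ m) =
      ∑ a : ZMod p, ∑ b : ZMod p, ρ (σ ^ a.val * τ ^ b.val) m := by
    unfold normSum
    simp only [map_sum, map_mul]
    rfl
  have h4 : (∑ i : ZMod p, ∑ j : ZMod p, ρ (σ ^ i.val * τ ^ (j * i).val) m) =
      p • m + ∑ i ∈ Finset.univ.erase (0 : ZMod p), ∑ b : ZMod p, ρ (σ ^ i.val * τ ^ b.val) m := by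
    rw [← Finset.add_sum_erase _ _ (Finset.mem_univ (0 : ZMod p))]
    congr 1
    · simp [ZMod.card]
    · refine Finset.sum_congr rfl fun i hi => ?_
      have hi0 : i ≠ 0 := Finset.ne_of_mem_erase hi
      exact Equiv.sum_comp (Equiv.mulRight₀ i hi0) (fun b : ZMod p => ρ (σ ^ i.val * τ ^ b.val) m)
  have h5 : (∑ a : ZMod p, ∑ b : ZMod p, ρ (σ ^ a.val * τ ^ b.val) m) =
      (∑ b : ZMod p, ρ (σ ^ (0 : ZMod p).val * τ ^ b.val) m) +
        ∑ a ∈ Finset.univ.erase (0 : ZMod p), ∑ b : ZMod p, ρ (σ ^ a.val * τ ^ b.val) m :=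
    (Finset.add_sum_erase _ _ (Finset.mem_univ _)).symm
  rw [Finset.sum_congr rfl fun j _ => h1 j, Finset.sum_comm, h3, h2, h4, h5]
  abel

/-- Consequence: `p • m = Σ_{j mod p} N_{στ^j} m + N_τ m - N_σ (N_τ m)`, a signed sum of elements
fixed by some `στ^j` or by `τ` (`apply_normSum_self`, `apply_normSum_comm`). [folklore] -/
theorem nsmul_eq_sum_normSum {σ τ : G} (hστ : Commute σ τ) (hτ : τ ^ p = 1) (m : M) :
    p • m = (∑ j : ZMod p, normSum ρ p (σ * τ ^ j.val) m) + normSum ρ p τ m -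
      normSum ρ p σ (normSum ρ p τ m) := by
  rw [sum_normSum_add_normSum ρ hστ hτ m, add_sub_cancel_right]

end Norms

end Literature.Barriers.BirchSwinnertonDyer
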